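import Summits.Ventures.PercRepro.Night2BasisCapFloor

/-!
# night-2: BLOCKING sets — the targets above `Q ∪ X` request nothing

For a basis pair `(B, z)` (`Q = insert z B`, `W = G ∖ Q`) a set `X ⊆ W` is BLOCKING when every face of `Q` is
blocked: for each `w ∈ Q ∖ K` either some `x ∈ X` lies off `clF (Q.erase w)` (so `w` is not a coloop of any
target containing `X`) or `(W ∖ X) ∪ {w}` has rank `≤ 4` (so no face at `w` of such a target is a thin member,
`notMem_thinMembers_of_rkN_sdiff_le_four`).  Then `L1 T = 0` at every target `T ⊇ Q ∪ X`
(`L1_eq_zero_of_blocking`), `capS T ≤ vCap T` there when unloaded (`capS_le_vCap_of_blocking`), and the face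
criterion needs only the unloaded targets above `Q ∪ X` with the full layer-0 capacity `capS`
(`basis_pair_fair_of_blocking_sum`).  The fat split `{x}` is blocking (`blocking_of_fat_split`), so the fat case
is the instance `X = {x}`; in the non-fat case a point off every member-face hyperplane is blocking.
Paper `proofs/NIGHT-2-g32.md` §3 (numerics: the blocking sum is `≥ 1.9` on every instance run, `|X| = 1` on all).
-/

namespace PercRepro.Shadow

open PercRepro.ThmH PercRepro.PerFlat

variable {α : Type*} [DecidableEq α] {M : Matroid α} [M.Finite] {G : Finset α}

/-- A blocking set for the basis pair `(B, z)`: every `w ∈ Q ∖ K` is blocked by a point of `X` off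
`clF (Q.erase w)` or by the rank condition `rk ((G ∖ Q ∖ X) ∪ {w}) ≤ 4`. -/
def Blocking (M : Matroid α) [M.Finite] (G B : Finset α) (z : α) (X : Finset α) : Prop :=
  X ⊆ G \ insert z B ∧ ∀ w ∈ insert z B \ coloops M G,
    (∃ x ∈ X, x ∉ clF M ((insert z B).erase w)) ∨ rkN M (((G \ insert z B) \ X) ∪ {w}) ≤ 4

/-- **No face of a target above `Q ∪ X` is a thin member** when `X` is blocking. -/
theorem not_faceOk_of_blocking (hG : G ∈ flatsQ M (5 + 1)) (hd : (gr M \ G).card = 2)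
    {B : Finset α} (hB : B ∈ thinMembers M 5 G) {z : α} (hz : z ∈ G \ clF M B) {X : Finset α}
    (hX : Blocking M G B z X) {T : Finset α} (hT : T ∈ tgtSets M 5 G B z) (hXT : X ⊆ T)
    {w : α} (hw : w ∈ T \ coloops M G) : ¬ faceOk M G T w := by
  intro hok
  obtain ⟨hthin, hwcl⟩ := hok
  have hGg : G ⊆ gr M := (mem_flatsQ.1 hG).1
  have hTG : T ⊆ G := subset_G_of_mem_shadowAt (mem_tgtSets.1 hT).1
  have hQT : insert z B ⊆ T := (mem_tgtSets.1 hT).2.1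
  have hQ6 := rkN_insert_eq_six_of_thin hG hB hz
  have h5 := rkN_eq_five_of_mem_thinMembers hthin
  rw [Finset.mem_sdiff] at hw
  -- `w ∈ Q`: otherwise `T.erase w ⊇ Q` has rank `6`
  have hwQ : w ∈ insert z B := by
    by_contra hwQ
    have hsub : insert z B ⊆ T.erase w := by
      intro e he
      rw [Finset.mem_erase]
      exact ⟨fun h => hwQ (h ▸ he), hQT he⟩
    have := rkN_mono (M := M) hsub
    omega
  rcases hX.2 w (Finset.mem_sdiff.2 ⟨hwQ, hw.2⟩) with ⟨x, hxX, hxcl⟩ | hr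
  · -- `x ∈ T.erase w ⊆ clF (T.erase w) = clF (Q.erase w)`
    have hxQ : x ∈ G \ insert z B := hX.1 hxX
    have hxw : x ≠ w := fun h => (Finset.mem_sdiff.1 hxQ).2 (h ▸ hwQ)
    have hxT : x ∈ T.erase w := Finset.mem_erase.2 ⟨hxw, hXT hxX⟩
    have hsub : (insert z B).erase w ⊆ T.erase w := Finset.erase_subset_erase _ hQT
    have hcl : clF M ((insert z B).erase w) = clF M (T.erase w) := by
      apply clF_eq_clF_of_subset_clF_of_rkN_le ((Finset.erase_subset _ _).trans (hTG.trans hGg))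
        (hsub.trans (subset_clF_of_subset_gr ((Finset.erase_subset _ _).trans (hTG.trans hGg))))
      have h1 := rkN_erase_ge (M := M) (insert z B) w
      have h2 := rkN_mono (M := M) hsub
      omega
    apply hxcl
    rw [hcl]
    exact subset_clF_of_subset_gr ((Finset.erase_subset _ _).trans (hTG.trans hGg)) hxT
  · -- the rank condition: `G ∖ (T.erase w) ⊆ ((G ∖ Q) ∖ X) ∪ {w}`
    apply notMem_thinMembers_of_rkN_sdiff_le_four hd _ hthin
    refine le_trans (rkN_mono (M := M) ?_) hr
    intro e he
    rw [Finset.mem_sdiff, Finset.mem_erase] at he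
    rw [Finset.mem_union, Finset.mem_sdiff, Finset.mem_sdiff, Finset.mem_singleton]
    by_cases hew : e = w
    · exact Or.inr hew
    · have heT : e ∉ T := fun h => he.2 ⟨hew, h⟩
      exact Or.inl ⟨⟨he.1, fun h => heT (hQT h)⟩, fun h => heT (hXT h)⟩

/-- **`L1 = 0` at every target above `Q ∪ X` for a blocking set `X`.** -/
theorem L1_eq_zero_of_blocking (hG : G ∈ flatsQ M (5 + 1)) (hd : (gr M \ G).card = 2)
    {B : Finset α} (hB : B ∈ thinMembers M 5 G) {z : α} (hz : z ∈ G \ clF M B) {X : Finset α}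
    (hX : Blocking M G B z X) {T : Finset α} (hT : T ∈ tgtSets M 5 G B z) (hXT : X ⊆ T) :
    L1 M 5 G T = 0 := by
  rw [L1_eq_sum_req_faces hG hd]
  apply Finset.sum_eq_zero
  intro w hw
  rw [Finset.mem_filter] at hw
  exact (not_faceOk_of_blocking hG hd hB hz hX hT hXT hw.1 hw.2).elim

/-- `capS ≤ 1` (`k1 ≥ 0`). -/
theorem capS_le_one (G S : Finset α) : capS M 5 G S ≤ 1 := by
  unfold capS
  have : (0 : ℚ) ≤ (k1 M 5 G S : ℚ) * phiQ 5 / (1 + ((gr M \ G).card : ℚ)) :=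
    div_nonneg (mul_nonneg (Nat.cast_nonneg _) (phiQ_pos 5).le) (by positivity)
  linarith

/-- **`capS ≤ vCap` at an unloaded target above `Q ∪ X`** for a blocking set `X`. -/
theorem capS_le_vCap_of_blocking (hG : G ∈ flatsQ M (5 + 1)) (hd : (gr M \ G).card = 2)
    {B : Finset α} (hB : B ∈ thinMembers M 5 G) {z : α} (hz : z ∈ G \ clF M B) {X : Finset α}
    (hX : Blocking M G B z X) {T : Finset α} (hT : T ∈ tgtSets M 5 G B z) (hXT : X ⊆ T)
    (h0 : dload M 5 G (bigP M G) (dshGT2 M 5 G) T = 0) : capS M 5 G T ≤ vCap M G T := by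
  have hL := L1_eq_zero_of_blocking hG hd hB hz hX hT hXT
  unfold vCap
  split_ifs with h1
  · exact capS_le_one G T
  · rw [hL, sub_zero]
    exact le_max_right _ _

/-- **The basis pairs' fair share from a blocking set**: `1 ≤ Σ_{T ∈ tgtSets B z, X ⊆ T, dload T = 0}
capS T / faceSum T` for a blocking set `X` gives the fair share of the lossy basis pair. -/
theorem basis_pair_fair_of_blocking_sum (hG : G ∈ flatsQ M (5 + 1)) (hd : (gr M \ G).card = 2)
    (hk : kColoops M G = 1) (hs : ∀ e ∈ gr M, ∀ f ∈ gr M, e ≠ f → rkN M {e, f} = 2)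
    (hl : ∀ e ∈ gr M, M.Indep {e}) (hfat : (fatClosures M 5 G 2).card ≤ 1)
    {B : Finset α} (hB : B ∈ thinMembers M 5 G) (hnP : ¬ bigP M G B) {z : α} (hz : z ∈ G \ clF M B)
    (hl0 : loss M 5 G B z ≠ 0) {X : Finset α} (hX : Blocking M G B z X)
    (hsum : 1 ≤ ∑ T ∈ (tgtSets M 5 G B z).filter
      (fun T => X ⊆ T ∧ dload M 5 G (bigP M G) (dshGT2 M 5 G) T = 0), capS M 5 G T / faceSum M G T) :
    loss M 5 G B z ≤ rhoL M 5 G B z * lossIncomeH M 5 G (bigP M G) (dshGT2 M 5 G) B z := by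
  apply basis_pair_fair_of_vCap_face_sum_subfamily (𝒯 := (tgtSets M 5 G B z).filter
    (fun T => X ⊆ T ∧ dload M 5 G (bigP M G) (dshGT2 M 5 G) T = 0)) hG hd hk hs hl hfat hB hnP hz hl0
    (Finset.filter_subset _ _)
  refine le_trans hsum (Finset.sum_le_sum ?_)
  intro T hT
  rw [Finset.mem_filter] at hT
  apply div_le_div_of_nonneg_right _ (faceSum_nonneg T)
  exact capS_le_vCap_of_blocking hG hd hB hz hX hT.1 hT.2.1 hT.2.2

/-- **The fat split is blocking**: with `G ∖ clF B₀ = {w₀, x}`, `w₀ ∈ Q`, `x ∉ Q`, the singleton `{x}` blocks every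
face of `Q` (`w₀` through `x ∉ clF (Q.erase w₀) ⊆ clF B₀`, every other `w` through the rank condition
`(G ∖ Q ∖ {x}) ∪ {w} ⊆ clF B₀ ∖ K`). -/
theorem blocking_of_fat_split (hG : G ∈ flatsQ M (5 + 1)) (hd : (gr M \ G).card = 2) (hk : kColoops M G = 1)
    {B₀ : Finset α} (hB₀ : B₀ ∈ thinMembers M 5 G) {w₀ x : α} (hD : G \ clF M B₀ = {w₀, x})
    {B : Finset α} (hB : B ∈ thinMembers M 5 G) {z : α} (hz : z ∈ G \ clF M B)
    (hw₀ : w₀ ∈ insert z B) (hx : x ∉ insert z B) : Blocking M G B z {x} := by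
  have hd' : (gr M \ G).card ≤ 5 := by omega
  have hGg : G ⊆ gr M := (mem_flatsQ.1 hG).1
  have hQG : insert z B ⊆ G :=
    Finset.insert_subset (Finset.mem_sdiff.1 hz).1 (subset_G_of_mem_thinMembers hB)
  have hKQ : coloops M G ⊆ insert z B :=
    (coloops_subset_of_mem_thinMembers hG hd' hB).trans (Finset.subset_insert _ _)
  have hoff : ∀ e ∈ G, e ∉ clF M B₀ → e = w₀ ∨ e = x := by
    intro e he hcl
    have : e ∈ ({w₀, x} : Finset α) := by
      rw [← hD, Finset.mem_sdiff]
      exact ⟨he, hcl⟩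
    simpa using this
  have hxG : x ∈ G \ clF M B₀ := by
    rw [hD]
    exact Finset.mem_insert_of_mem (Finset.mem_singleton_self _)
  refine ⟨Finset.singleton_subset_iff.2 (Finset.mem_sdiff.2 ⟨(Finset.mem_sdiff.1 hxG).1, hx⟩), ?_⟩
  intro w hw
  rw [Finset.mem_sdiff] at hw
  have hxcl : x ∉ clF M B₀ := (Finset.mem_sdiff.1 hxG).2
  by_cases hww₀ : w = w₀
  · -- `x ∉ clF (Q.erase w₀) ⊆ clF B₀`
    subst hww₀
    left
    refine ⟨x, Finset.mem_singleton_self _, fun hxc => hxcl ?_⟩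
    have hQe : (insert z B).erase w ⊆ clF M B₀ := by
      intro e he
      rw [Finset.mem_erase] at he
      by_contra hcl
      rcases hoff e (hQG he.2) hcl with rfl | rfl
      · exact he.1 rfl
      · exact hx he.2
    exact clF_subset_clF_of_subset_clF hQe hxc
  · right
    have hwcl : w ∈ clF M B₀ := by
      by_contra h
      rcases hoff w (hQG hw.1) h with rfl | rfl
      · exact hww₀ rfl
      · exact hx hw.1
    have hsub : ((G \ insert z B) \ {x}) ∪ {w} ⊆ clF M B₀ \ coloops M G := by
      intro e he
      rw [Finset.mem_union, Finset.mem_sdiff, Finset.mem_sdiff, Finset.mem_singleton, Finset.mem_singleton] at he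
      rw [Finset.mem_sdiff]
      rcases he with ⟨⟨heG, heQ⟩, hex⟩ | rfl
      · refine ⟨?_, fun h => heQ (hKQ h)⟩
        by_contra hcl
        rcases hoff e heG hcl with rfl | rfl
        · exact heQ hw₀
        · exact hex rfl
      · exact ⟨hwcl, hw.2⟩
    calc rkN M (((G \ insert z B) \ {x}) ∪ {w}) ≤ rkN M (clF M B₀ \ coloops M G) := rkN_mono hsub
      _ = 4 := rkN_clF_sdiff_coloops_eq_four_two hG hd hk hB₀

end PercRepro.Shadow
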